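import Literature.NumberTheory.Rogawski1990.TransferFactsCartanKappa            -- ★ #72 ED. 5 + §2 (`finite_cartanIndex`, R7a, `cartanObsHasse`): the POINTED package
import Literature.NumberTheory.Rogawski1990.GlobalTransferWithCMCharIdentities    -- ★ P3b (J1) joint letter + ★ ED. 5 parametric `GlobalTransferWithStabilisationPackageAnd Q` + ★ `CMCharIdentityPackage`
import Literature.NumberTheory.Rogawski1990.FinExplicitTransferFactorConjRight    -- ★ N1f ⊕ N1f-l ⊕ N1f-r: `Δ‴ = finExplicitCollection …` UNCONDITIONAL
import Literature.NumberTheory.Rogawski1990.ArchCanonicalTransferFactor           -- ★ `archCanonicalDelta` ∕ `archCanonicalTransferFactor` = `Δ‴_∞`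
import Literature.NumberTheory.Automorphic.QuadraticHeckeCharacterCM              -- ★ `quadraticHeckeCharCM` = `ω_{L∕L⁺}` (the μ-guard)
import Literature.NumberTheory.Rogawski1990.CharIdentityOnTestFunctions           -- ★ p840183 A-p19 (g21) R1∕R2: `CMCharIdentityPackageTest` — Q-CM RE-TYPED ON TEST FUNCTIONS (ED. 3ᵀ)
import Summits.HodgeConjecture.HodgeConjecture.Cruxes.H413.Lines.F0_P3a_GlobalTransferCartanKappaPaydown  -- T6-L3 (nested line, registered 971bfc3bec9d): its pointed head closes (J‴)
import HarnessLib

/-!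
# LINE «GlobalTransferWithStabilisationPackageAnd Q» (#72 WITH ITS RIDER `Q`) PAY-DOWN AT THE EXPLICIT COLLECTION `Δ‴` — skeleton DRAFT
# (T6-L4 OUTER line; B-p17 (g20) pen per LEAD DESK WORD T6-11 (4)(5); nested line T6-L3 `F0_P3a_GlobalTransferCartanKappaPaydown` (F0P3a-p08);
# the registrar A-plan1 cuts ∕ writes; NO `skeleton check` (s579))
# ED. 3ᵀ («T6-L4ᵀ», LEAD F0P3a-plan (g9) WORD T8-30 (C); pen B-p10 (g24)): the OUTER stub (Q-CM) RE-TYPED ON TEST FUNCTIONS — ★ `CMCharIdentityPackage` ↦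
# ★ `CMCharIdentityPackageTest` (A-p19 (g21) ★ p840183), binder block unchanged = F0P3b's registered `QCMT` (`F0_P3b_CMCharIdentityTestPaydown.lean` 2150a994adb2 :132–:154)
# token for token under {`Pl` ↦ `HeightOneSpectrum (𝓞 L⁺)`, `HLoc`∕`GLoc` unfolded, `H` ↦ `H′`, `_hμω` ↦ `hμω`}; ONLY-OUT {`stub_cmCharIdentity_explicit`, `globalTransferWithCMCharIdentities_explicit_holds`},
# ONLY-IN {`stub_cmCharIdentityTest_explicit`, `globalTransferWithCMCharIdentitiesTest_explicit_holds`}; every other declaration byte-identical to ED. 2 (935b4dd9950d9002).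

Cell `hodgecm-mathlib`, F0∕P3a, crux H413 (`stmt-HodgeConjecture-24833`).  The T1 head's transfer antecedent is `hGTQ : GlobalTransferWithStabilisationPackageAnd L H Tinf.Δ νH νG Q`
(MAIN-b `F0_T1InnerFormTraceIdentity` :1425, export `anchoredKit_nonempty_of_stubsQ` :1534; `Q` a BINDER there, instantiated at rung 1 by `Q_K9 …` =
`CMCharIdentityPackage … ∧ <override witness>`, `F0_U3LettersRung1` :1047–1057, :880–892): ★ ED. 5 parametric letter `GlobalTransferWithStabilisationPackageAnd`
[Rogawski1990 Prop. 4.9.1 + (4.3.1)–(4.3.3) + §3.3 ∕ §5.4] = ONE existential over `(S_bad, Δ, m_H, m_G)` carrying local transfer data everywhere, the unit fundamental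
lemma off `S_bad`, the product formula with `Δ_∞`, the per-class STABILISATION PACKAGE, AND the rider `Q Δ m_H m_G` on the SAME witness (RULING (V29)).  This line
INSTANTIATES it at PRINT'S OWN WITNESS: `Δ := Δ‴ = finExplicitCollection L H′ μ …` (★ typ-T6b N1f ⊕ N1f-l ⊕ N1f-r), `Δ_∞ := Δ‴_∞ = fun a b => archCanonicalDelta L H′ a μ b`
(★ `archCanonicalTransferFactor L H′ μ`, `.Δ`-equal by `rfl`) and the CANONICAL measure families delivered by the nested line T6-L3.  HONEST LABEL: HC_CM is proved only
modulo the printed citations until rung 0 closes; this skeleton discharges NOTHING until its stubs close; its net effect at birth is 0 letters — its VALUE is that the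
`Q`-rider (rung 1: Rogawski's CM character identities [13.1.4] + the override witness) is thereafter stated AT PRINT'S `Δ‴` AND CANONICAL MEASURES (print-backed; the
(V29) Δ-twist caveat dissolves for the CM instance), and #72 retires from the books when (J‴) closes (the letters N6∕N7 then ride inside T6-L3 only).

THE CUT (T6-4 convention):
* `stub_globalTransferCartanKappa_pointed` (J‴) — JUNCTION, closes BY NAME from T6-L3's POINTED head `F0P3aGlobalTransferCartanKappaPaydown.globalTransferCartanKappa_pointed
  L H′ μ νH νG hμu hμω hherm hanis` (its statement token for token: under the level guards, `∃ (S_bad, mH, mG)` with EVERY conjunct of ★ `GlobalTransferWithCartanKappaFormula`'s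
  body AT `(Δ‴, Δ‴_∞)` — per place ⟨transfer datum, unit FL off `S_bad`, `mH` canonical, `mG` canonical⟩, a.e.-triviality, product formula, the κ-clause (4.3.3) for Kottwitz's
  `cartanObs`); ED. 1: a `sorry`; ED. 2 (this text, T6-L3 registered 971bfc3bec9d and built): CLOSED BY NAME — its content is now T6-L3's own sorries
  (letters N6 [LS₂], N7 [BR₁]; payable N5 in flight; N3 closes in T6-L3 ED. 2).
* (PKG-pt) — PROVED HERE, no stub: `stabilisationPackage_pointed` — «κ-clause at `(Δ, Δ_∞)` ⇒ the per-class stabilisation package of ED. 4 at the same `(Δ, Δ_∞)`» for ANY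
  collection (the pointed form of ★ `GlobalTransferWithCartanKappaFormula.stabilisationPackage'`: `A := A(γ₀)`, `𝓡 := ⊤`, `obs := cartanObs`, `(s, e)` from ★ R7a
  `exists_endoscopicKappaEquiv_of_obsHasse` with Prop. 3.3.1 ★ `cartanObsHasse`; [Rogawski1990 §3.3 Prop. 3.3.1 p. 22, §5.4 (5.4.5) p. 73, §4.3 (4.3.3) p. 44]).
* `hQ` — the `Q`-LETTER AS A FRAME HYPOTHESIS of the generic head (census (b): the consumer's `Q` is `Q_K9`, not the bare CM package): «`Q Δ‴ mH mG` for EVERY pair of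
  CANONICAL families `(mH, mG)`» — rung 1 supplies it for `Q_K9`.
* `stub_cmCharIdentityTest_explicit` (Q-CMᵀ, ED. 3ᵀ) — LETTER BY NAME for the CM corollary: ★ `CMCharIdentityPackageTest L H′ hherm hHd νH νG μ hμu Δ‴ mH mG` for every pair of
  canonical families [Rogawski1990 §13.1 Prop. 13.1.4 p. 199; §4.13 Lemma 4.13.1 (b) p. 63; §12.2 p. 174] — Rogawski's character identities AT HIS OWN transfer factor `Δ‴` (the `μ` of
  §4.9 and of §13.1 is the same auxiliary character) and compatible (canonical) measures, with the identities quantified over TEST FUNCTIONS (`IsLocSmooth`, print's `C(G, ω)`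
  §4.1 p. 40) — print-backed as typed.  WHY RE-TYPED: the ED. 1∕2 text ★ `CMCharIdentityPackage` quantifies `χ_ξ(f^H) = Σ Tr π(f)` over ALL bare functions while
  `Tr := IrrClass.smoothTrace` is `0` off the test functions, so with N6-shape transfer existence it FORCES every packet character to vanish (F0P3b-plan (g11) FINDING-QCM-JUNK,
  kernel-checked `Cruxes/H413/Lines/F0_P3b_QCMJunkObstruction.lean` a615f73d90f5; LEAD T8-21 class MISSTATED) — junk-vacuous; the Test text is the same two clauses restricted to
  `C_c^∞` and is the statement of record #86T = F0P3b's head `QCMT` = the closer's `stub_QCMT` (ED. 19b).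
COMPOSITION `globalTransferPackageAnd_of_stubs` (kernel-checked, no `sorry`): open (J‴) → `(S_bad, mH, mG)` + clauses; the package conjunct from `stabilisationPackage_pointed`;
`Q Δ‴ mH mG` from `hQ` at the canonical clauses; pack `⟨S_bad, Δ‴, mH, mG, …⟩`.  HEADS: `globalTransferPackageAnd_holds (hQ)` at `fun a b => archCanonicalDelta …`,
`globalTransferPackageAnd_holds' (hQ)` at `(archCanonicalTransferFactor L H′ μ).Δ` (the consumer's `Tinf.Δ` spelling), and the CM corollary ON TEST FUNCTIONS
`globalTransferWithCMCharIdentitiesTest_explicit_holds` (★ ED. 5 `GlobalTransferWithStabilisationPackageAnd` at `Δ‴_∞` and `Q := CMCharIdentityPackageTest …` — the Test twin of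
★ P3b `GlobalTransferWithCMCharIdentities`, spelled through ED. 5 since no `…Test` joint-letter definition exists; over (J‴) + (Q-CMᵀ)).
FRAME (T6-4 (i), = T6-L3's VERBATIM): per-place Borel structures, `[∀ v, IsHaarMeasure (νH v)] [∀ v, (νH v).IsMulRightInvariant]`, same for `νG` (the consumers' families are Haar:
rung 1 `isHaar_νH ∕ isHaar_νG`); the μ-guard `hμu hμω` by `include … in` (O211-1); `hherm hanis` explicit; `Q` typed EXACTLY as ★ `GlobalTransferWithStabilisationPackageAnd`'s binder.
DEF∕PROOF discipline: THEOREMS ONLY; `sorry` ONLY inside the open stub (Q-CMᵀ) (ED. 1: also (J‴)); no instance, no notation; no `set_option` beyond `autoImplicit false` ∕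
`linter.dupNamespace false`; `--supports stmt-HodgeConjecture-24833`.  NOT FILED by this seat (registrar A-plan1 `crux write`s).  Junction test BY PASTE against T6-L3 v2 on the bus.
-/

set_option autoImplicit false
set_option linter.dupNamespace false

noncomputable section

open NumberField IsDedekindDomain MeasureTheory Measure
open Literature.NumberTheory.Rogawski1990 Literature.NumberTheory.Automorphic Literature.NumberTheory.GaloisRepresentations
open Literature.AlgebraicGeometry.ShimuraVarieties (unitaryGroup hermForm)
open scoped Matrix MatrixGroups Classical

namespace Summit.HodgeConjecture.HodgeConjecture.Cruxes.H413.F0P3aGlobalTransferPackageAndPaydown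

/-! ## §0 (PKG-pt) — PROVED: the per-class stabilisation package at a GIVEN collection from the κ-clause at that collection -/

section Pointed

variable (L : Type) [Field L] [NumberField L] [IsCMField L] (H' : Matrix (Fin 3) (Fin 3) L)
  (Δinf : ↥(UnitaryGroup.arch (↥(maximalRealSubfield L)) L (IsCMField.complexConj L) 2
        (Matrix.of fun i j : Fin 2 => if i.val + j.val + 1 = 2 then (1 : L) else 0)) ×
      ↥(UnitaryGroup.arch (↥(maximalRealSubfield L)) L (IsCMField.complexConj L) 1
        (Matrix.of fun i j : Fin 1 => if i.val + j.val + 1 = 1 then (1 : L) else 0)) →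
    ↥(UnitaryGroup.arch (↥(maximalRealSubfield L)) L (IsCMField.complexConj L) 3 H') → ℂ)
  (Δ : ∀ v : HeightOneSpectrum (𝓞 ↥(maximalRealSubfield L)), LocalTransferFactor L H' v)

/-- **(PKG-pt) THE POINTED RUNG-0 SWAP**: for a hermitian `H′` and ANY global collection `(Δ_v)_v` with archimedean factor `Δ_∞`, the κ-CLAUSE of ★
`GlobalTransferWithCartanKappaFormula` at `(Δ, Δ_∞)` — the identity (4.3.3) `Δ_𝐀(γ_H, γ̄) Δ_∞ = (e 𝒪H)(cartanObs γ̄)` for Kottwitz's concrete obstruction and every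
pinned dictionary `(s, e)` — implies the PER-CLASS STABILISATION PACKAGE of ★ ED. 4 `GlobalTransferWithStabilisationPackage` at the same `(Δ, Δ_∞)`: at a regular `γ₀` of
the anisotropic `U(H′)` take `A := A(γ₀)` (`cartanObsSubgroup (cartanIndexCM …)`, finite by ★ `finite_cartanIndex`), `𝓡 := ⊤`, `obs := cartanObs`, and `(s, e)` with
clause (a) [Prop. 3.3.1] in character form from ★ R7a `MatchingAdeleG₂.exists_endoscopicKappaEquiv_of_obsHasse` fed with ★ R7 `cartanObsHasse`.  This is ★
`GlobalTransferWithCartanKappaFormula.stabilisationPackage'` with the `∃ (S_bad, Δ, mH, mG)` peeled off — the form the outer line needs to keep print's witness `Δ‴` in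
hand. [cite: Rogawski1990, §3.3 Prop. 3.3.1 p. 22; §5.4 (5.4.5) p. 73; §4.3 (4.3.3) p. 44] [cite: Kottwitz1986, §9] [cite: LanglandsShelstad1987, §6.4 Cor. 6.4.B] -/
theorem stabilisationPackage_pointed (hherm : (H'.map (cmConjRingHom L))ᵀ = H')
    (hκ :
          ((∀ x : Fin 3 → L, hermForm (cmConjRingHom L) H' x x = 0 → x = 0) →
            ∀ (hH : (H'.map (cmConjRingHom L))ᵀ = H') (hHd : IsUnit H'.det)
              (γ₀ : (UnitaryGroup.cmDatum L 3 H').Rational) (hreg : IsRegularElt (γ₀.val : GL (Fin 3) L))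
              [Fintype (cartanIndexCM hH hHd hreg)]
              (s : {𝒪H : StableClassH (cmConjRingHom L) (Matrix.of fun i j : Fin 2 => if i.val + j.val + 1 = 2 then (1 : L) else 0)
                      (Matrix.of fun i j : Fin 1 => if i.val + j.val + 1 = 1 then (1 : L) else 0) //
                    𝒪H.TransfersTo H' endoForm_antidiagOne (stableClassOf (cmConjRingHom L) H' γ₀)} → cartanIndexCM hH hHd hreg)
              (e : {𝒪H : StableClassH (cmConjRingHom L) (Matrix.of fun i j : Fin 2 => if i.val + j.val + 1 = 2 then (1 : L) else 0)
                      (Matrix.of fun i j : Fin 1 => if i.val + j.val + 1 = 1 then (1 : L) else 0) //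
                    𝒪H.TransfersTo H' endoForm_antidiagOne (stableClassOf (cmConjRingHom L) H' γ₀)} ≃
                  {χ : (⊤ : Subgroup (AddChar ↥(cartanObsSubgroup (cartanIndexCM hH hHd hreg)) ℂ)) // χ ≠ 1}),
              Function.Injective s →
              (∀ 𝔪 : cartanIndexCM hH hHd hreg, (∃ x, s x = 𝔪) ↔ Module.finrank L (↥(Algebra.adjoin L ({(((γ₀ : unitaryGroup (cmConjRingHom L) H').val : GL (Fin 3) L) : Matrix (Fin 3) (Fin 3) L)} :
                          Set (Matrix (Fin 3) (Fin 3) L))) ⧸ 𝔪.1.asIdeal) = 1) →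
              (∀ x, (⟨(((γ₀ : unitaryGroup (cmConjRingHom L) H').val : GL (Fin 3) L) : Matrix (Fin 3) (Fin 3) L), Algebra.self_mem_adjoin_singleton L _⟩ :
                      ↥(Algebra.adjoin L ({(((γ₀ : unitaryGroup (cmConjRingHom L) H').val : GL (Fin 3) L) : Matrix (Fin 3) (Fin 3) L)} :
                          Set (Matrix (Fin 3) (Fin 3) L)))) -
                  algebraMap L _ x.1.sndVal ∈ (s x).1.asIdeal) →
              (∀ x (ε : ↥(cartanObsSubgroup (cartanIndexCM hH hHd hreg))),
                  (((e x : (⊤ : Subgroup (AddChar ↥(cartanObsSubgroup (cartanIndexCM hH hHd hreg)) ℂ))) : AddChar ↥(cartanObsSubgroup (cartanIndexCM hH hHd hreg)) ℂ)) ε =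
                    (-1 : ℂ) ^ ((ε : cartanIndexCM hH hHd hreg → ZMod 2) (s x)).val) →
              ∀ (γH : (UnitaryGroup.cmDatum L 2 (Matrix.of fun i j : Fin 2 => if i.val + j.val + 1 = 2 then (1 : L) else 0)).Rational ×
                  (UnitaryGroup.cmDatum L 1 (Matrix.of fun i j : Fin 1 => if i.val + j.val + 1 = 1 then (1 : L) else 0)).Rational)
                (hγ : IsNormPair L H' γH γ₀),
                GlobalKappaFormula L H' Δ Δinf
                  (fun p : MatchingAdele L H' γH => MatchingAdeleG₂.cartanObs hH hHd hreg (MatchingAdele.toSelf hγ p))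
                  (((e ⟨stableClassHOf (cmConjRingHom L) _ _ γH, hγ⟩).1 :
                      (⊤ : Subgroup (AddChar ↥(cartanObsSubgroup (cartanIndexCM hH hHd hreg)) ℂ))) : AddChar ↥(cartanObsSubgroup (cartanIndexCM hH hHd hreg)) ℂ))) :
    ((∀ x : Fin 3 → L, hermForm (cmConjRingHom L) H' x x = 0 → x = 0) →
      ∀ γ₀ : (UnitaryGroup.cmDatum L 3 H').Rational, IsRegularElt (γ₀.val : GL (Fin 3) L) →
        ∃ (A : Type) (_ : AddCommGroup A) (𝓡 : Subgroup (AddChar A ℂ)) (_ : Fintype 𝓡) (obs : MatchingAdeleG₂ L H' H' γ₀ → A)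
          (e : {𝒪H : StableClassH (cmConjRingHom L) (Matrix.of fun i j : Fin 2 => if i.val + j.val + 1 = 2 then (1 : L) else 0)
                  (Matrix.of fun i j : Fin 1 => if i.val + j.val + 1 = 1 then (1 : L) else 0) //
                𝒪H.TransfersTo H' endoForm_antidiagOne (stableClassOf (cmConjRingHom L) H' γ₀)} ≃ {χ : 𝓡 // χ ≠ 1}),
          (∀ p : MatchingAdeleG₂ L H' H' γ₀, (∀ κ ∈ 𝓡, κ (obs p) = 1) ↔ ∃ γ, p.IsRationalOver γ) ∧
          ∀ (γH : (UnitaryGroup.cmDatum L 2 (Matrix.of fun i j : Fin 2 => if i.val + j.val + 1 = 2 then (1 : L) else 0)).Rational ×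
              (UnitaryGroup.cmDatum L 1 (Matrix.of fun i j : Fin 1 => if i.val + j.val + 1 = 1 then (1 : L) else 0)).Rational)
            (hγ : IsNormPair L H' γH γ₀),
            GlobalKappaFormula L H' Δ Δinf (fun p : MatchingAdele L H' γH => obs (MatchingAdele.toSelf hγ p))
              ((e ⟨stableClassHOf (cmConjRingHom L) _ _ γH, hγ⟩).1 : AddChar A ℂ)) := by
  intro hanis γ₀ hreg
  have hHd : IsUnit H'.det := isUnit_iff_ne_zero.mpr (Godement.det_ne_zero_of_anisotropic L H' hanis)
  haveI : Finite (cartanIndexCM hherm hHd hreg) :=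
    finite_cartanIndex (cmConjRingHom L) (cmConjRingHom_algebraMap L) (IsCMField.complexConj_apply_apply L) hHd hherm hreg
      (transpose_map_mul_mul_eq_of_rational γ₀)
  haveI : Fintype (cartanIndexCM hherm hHd hreg) := Fintype.ofFinite _
  haveI : Fintype (⊤ : Subgroup (AddChar ↥(cartanObsSubgroup (cartanIndexCM hherm hHd hreg)) ℂ)) := Fintype.ofFinite _
  obtain ⟨s, e, hs, hrange, hdict, hpin, hchar⟩ :=
    MatchingAdeleG₂.exists_endoscopicKappaEquiv_of_obsHasse hherm hHd hanis hreg (MatchingAdeleG₂.cartanObs hherm hHd hreg)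
      (fun p => cartanObsHasse hherm hHd hreg p)
  exact ⟨_, inferInstance, ⊤, inferInstance, MatchingAdeleG₂.cartanObs hherm hHd hreg, e, hchar,
    fun γH hγ => hκ hanis hherm hHd γ₀ hreg s e hs hrange hdict hpin γH hγ⟩

end Pointed

/-! ## §1 Frame of the line (= T6-L3's, VERBATIM) and the two open stubs -/

variable (L : Type) [Field L] [NumberField L] [IsCMField L] (H' : Matrix (Fin 3) (Fin 3) L) (μ : HeckeCharacter L)
    [∀ v : HeightOneSpectrum (𝓞 ↥(maximalRealSubfield L)),
      MeasurableSpace ((UnitaryGroup.cmDatum L 2 (Matrix.of fun i j : Fin 2 => if i.val + j.val + 1 = 2 then (1 : L) else 0)).Local v ×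
        (UnitaryGroup.cmDatum L 1 (Matrix.of fun i j : Fin 1 => if i.val + j.val + 1 = 1 then (1 : L) else 0)).Local v)]
    [∀ v : HeightOneSpectrum (𝓞 ↥(maximalRealSubfield L)),
      BorelSpace ((UnitaryGroup.cmDatum L 2 (Matrix.of fun i j : Fin 2 => if i.val + j.val + 1 = 2 then (1 : L) else 0)).Local v ×
        (UnitaryGroup.cmDatum L 1 (Matrix.of fun i j : Fin 1 => if i.val + j.val + 1 = 1 then (1 : L) else 0)).Local v)]
    [∀ v : HeightOneSpectrum (𝓞 ↥(maximalRealSubfield L)), MeasurableSpace ((UnitaryGroup.cmDatum L 3 H').Local v)]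
    [∀ v : HeightOneSpectrum (𝓞 ↥(maximalRealSubfield L)), BorelSpace ((UnitaryGroup.cmDatum L 3 H').Local v)]
    (νH : ∀ v : HeightOneSpectrum (𝓞 ↥(maximalRealSubfield L)),
      Measure ((UnitaryGroup.cmDatum L 2 (Matrix.of fun i j : Fin 2 => if i.val + j.val + 1 = 2 then (1 : L) else 0)).Local v ×
        (UnitaryGroup.cmDatum L 1 (Matrix.of fun i j : Fin 1 => if i.val + j.val + 1 = 1 then (1 : L) else 0)).Local v))
    (νG : ∀ v : HeightOneSpectrum (𝓞 ↥(maximalRealSubfield L)), Measure ((UnitaryGroup.cmDatum L 3 H').Local v))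
    [∀ v, (νH v).IsHaarMeasure] [∀ v, (νH v).IsMulRightInvariant] [∀ v, (νG v).IsHaarMeasure] [∀ v, (νG v).IsMulRightInvariant]

section Stubs

variable (hμu : μ.IsUnitary)
  (hμω : ∀ x : ideleGroup ↥(maximalRealSubfield L), μ (AdeleRing.ideleBaseChange (↥(maximalRealSubfield L)) L x) = quadraticHeckeCharCM L x)

include hμu hμω in
/-- **STUB (J‴) — JUNCTION, closes BY NAME from the nested line T6-L3** (`F0P3aGlobalTransferCartanKappaPaydown.globalTransferCartanKappa_pointed L H′ μ νH νG hμu hμω hherm hanis`,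
statement token for token): under the level guards `νG_v(K′_v) = νH_v(K_{H,v}) = 1`, there are `(S_bad, mH, mG)` with, at every finite `v`, a local transfer datum at `Δ‴_v`,
the unit fundamental lemma off `S_bad`, `mH`∕`mG` CANONICAL for `νH_v`∕`νG_v`; `Δ‴` almost everywhere trivial; the product formula for `(Δ‴, Δ‴_∞)`; and the κ-clause
(4.3.3) for Kottwitz's `cartanObs` and every pinned dictionary `(s, e)` — i.e. the body of ★ `GlobalTransferWithCartanKappaFormula` AT PRINT'S WITNESS, `∃ Δ` peeled off.
Until T6-L3 is registered and built this `sorry` IS the booked junction (its content = T6-L3's letters N6 [LS₂], N7 [BR₁] + payables N3∕N4∕N5 in flight); under the μ-guard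
(true as typed only with it). [cite: Rogawski1990, §4.9 Prop. 4.9.1 (a), (b) p. 55; §4.3 (4.3.1)–(4.3.3) pp. 43–44; §14.6 p. 242] [cite: LanglandsShelstad1987, §6.4] -/
theorem stub_globalTransferCartanKappa_pointed (hherm : (H'.map (cmConjRingHom L)).transpose = H')
    (hanis : ∀ x : Fin 3 → L, hermForm (cmConjRingHom L) H' x x = 0 → x = 0) :
    (∀ v : HeightOneSpectrum (𝓞 ↥(maximalRealSubfield L)),
      νG v (UnitaryGroup.cmLocalIntegralLevel L 3 H' v : Set ((UnitaryGroup.cmDatum L 3 H').Local v)) = 1) →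
    (∀ v : HeightOneSpectrum (𝓞 ↥(maximalRealSubfield L)),
      νH v (((UnitaryGroup.cmLocalIntegralLevel L 2 (Matrix.of fun i j : Fin 2 => if i.val + j.val + 1 = 2 then (1 : L) else 0) v).prod
          (UnitaryGroup.cmLocalIntegralLevel L 1 (Matrix.of fun i j : Fin 1 => if i.val + j.val + 1 = 1 then (1 : L) else 0) v) :
            Subgroup ((UnitaryGroup.cmDatum L 2 (Matrix.of fun i j : Fin 2 => if i.val + j.val + 1 = 2 then (1 : L) else 0)).Local v ×
              (UnitaryGroup.cmDatum L 1 (Matrix.of fun i j : Fin 1 => if i.val + j.val + 1 = 1 then (1 : L) else 0)).Local v)) :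
          Set ((UnitaryGroup.cmDatum L 2 (Matrix.of fun i j : Fin 2 => if i.val + j.val + 1 = 2 then (1 : L) else 0)).Local v ×
            (UnitaryGroup.cmDatum L 1 (Matrix.of fun i j : Fin 1 => if i.val + j.val + 1 = 1 then (1 : L) else 0)).Local v)) = 1) →
    letI : ∀ (v : HeightOneSpectrum (𝓞 ↥(maximalRealSubfield L)))
        (a : ((UnitaryGroup.cmDatum L 2 (Matrix.of fun i j : Fin 2 => if i.val + j.val + 1 = 2 then (1 : L) else 0)).Local v ×
          (UnitaryGroup.cmDatum L 1 (Matrix.of fun i j : Fin 1 => if i.val + j.val + 1 = 1 then (1 : L) else 0)).Local v)),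
        MeasurableSpace (((UnitaryGroup.cmDatum L 2 (Matrix.of fun i j : Fin 2 => if i.val + j.val + 1 = 2 then (1 : L) else 0)).Local v ×
          (UnitaryGroup.cmDatum L 1 (Matrix.of fun i j : Fin 1 => if i.val + j.val + 1 = 1 then (1 : L) else 0)).Local v) ⧸
          Subgroup.centralizer ({a} : Set ((UnitaryGroup.cmDatum L 2 (Matrix.of fun i j : Fin 2 => if i.val + j.val + 1 = 2 then (1 : L) else 0)).Local v ×
          (UnitaryGroup.cmDatum L 1 (Matrix.of fun i j : Fin 1 => if i.val + j.val + 1 = 1 then (1 : L) else 0)).Local v))) :=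
      fun _ _ => borel _
    haveI : ∀ (v : HeightOneSpectrum (𝓞 ↥(maximalRealSubfield L)))
        (a : ((UnitaryGroup.cmDatum L 2 (Matrix.of fun i j : Fin 2 => if i.val + j.val + 1 = 2 then (1 : L) else 0)).Local v ×
          (UnitaryGroup.cmDatum L 1 (Matrix.of fun i j : Fin 1 => if i.val + j.val + 1 = 1 then (1 : L) else 0)).Local v)),
        BorelSpace (((UnitaryGroup.cmDatum L 2 (Matrix.of fun i j : Fin 2 => if i.val + j.val + 1 = 2 then (1 : L) else 0)).Local v ×
          (UnitaryGroup.cmDatum L 1 (Matrix.of fun i j : Fin 1 => if i.val + j.val + 1 = 1 then (1 : L) else 0)).Local v) ⧸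
          Subgroup.centralizer ({a} : Set ((UnitaryGroup.cmDatum L 2 (Matrix.of fun i j : Fin 2 => if i.val + j.val + 1 = 2 then (1 : L) else 0)).Local v ×
          (UnitaryGroup.cmDatum L 1 (Matrix.of fun i j : Fin 1 => if i.val + j.val + 1 = 1 then (1 : L) else 0)).Local v))) :=
      fun _ _ => ⟨rfl⟩
    letI : ∀ (v : HeightOneSpectrum (𝓞 ↥(maximalRealSubfield L))) (γ : (UnitaryGroup.cmDatum L 3 H').Local v),
        MeasurableSpace ((UnitaryGroup.cmDatum L 3 H').Local v ⧸ Subgroup.centralizer ({γ} : Set ((UnitaryGroup.cmDatum L 3 H').Local v))) :=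
      fun _ _ => borel _
    haveI : ∀ (v : HeightOneSpectrum (𝓞 ↥(maximalRealSubfield L))) (γ : (UnitaryGroup.cmDatum L 3 H').Local v),
        BorelSpace ((UnitaryGroup.cmDatum L 3 H').Local v ⧸ Subgroup.centralizer ({γ} : Set ((UnitaryGroup.cmDatum L 3 H').Local v))) :=
      fun _ _ => ⟨rfl⟩
    ∃ (Sbad : Finset (HeightOneSpectrum (𝓞 ↥(maximalRealSubfield L))))
      (mH : ∀ v : HeightOneSpectrum (𝓞 ↥(maximalRealSubfield L)), OrbitalMeasureFamily ((UnitaryGroup.cmDatum L 2 (Matrix.of fun i j : Fin 2 => if i.val + j.val + 1 = 2 then (1 : L) else 0)).Local v ×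
        (UnitaryGroup.cmDatum L 1 (Matrix.of fun i j : Fin 1 => if i.val + j.val + 1 = 1 then (1 : L) else 0)).Local v))
      (mG : ∀ v : HeightOneSpectrum (𝓞 ↥(maximalRealSubfield L)), OrbitalMeasureFamily ((UnitaryGroup.cmDatum L 3 H').Local v)),
      (∀ v, IsLocalTransferDatum L H' v ((finExplicitCollection L H' μ (finExplicitDelta_conj_left_all L H' μ) (finExplicitDelta_conj_right_all L H' μ)) v) (mH v) (mG v) ∧
          (v ∉ Sbad → IsLocalUnitTransfer L H' v ((finExplicitCollection L H' μ (finExplicitDelta_conj_left_all L H' μ) (finExplicitDelta_conj_right_all L H' μ)) v) (mH v) (mG v)) ∧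
          (mH v).IsCanonical (IsLocalGRegular L v) (νH v) ∧
          (mG v).IsCanonical (fun γ => IsRegularElt (γ.val : GL (Fin 3) (UnitaryGroup.LocalRing L v))) (νG v)) ∧
        IsAlmostEverywhereTrivial L H' (finExplicitCollection L H' μ (finExplicitDelta_conj_left_all L H' μ) (finExplicitDelta_conj_right_all L H' μ)) ∧
        SatisfiesProductFormula L H' (finExplicitCollection L H' μ (finExplicitDelta_conj_left_all L H' μ) (finExplicitDelta_conj_right_all L H' μ))
      (fun a b => archCanonicalDelta L H' a μ b) ∧
        ((∀ x : Fin 3 → L, hermForm (cmConjRingHom L) H' x x = 0 → x = 0) →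
      ∀ (hH : (H'.map (cmConjRingHom L))ᵀ = H') (hHd : IsUnit H'.det)
        (γ₀ : (UnitaryGroup.cmDatum L 3 H').Rational) (hreg : IsRegularElt (γ₀.val : GL (Fin 3) L))
        [Fintype (cartanIndexCM hH hHd hreg)]
        (s : {𝒪H : StableClassH (cmConjRingHom L) (Matrix.of fun i j : Fin 2 => if i.val + j.val + 1 = 2 then (1 : L) else 0)
                (Matrix.of fun i j : Fin 1 => if i.val + j.val + 1 = 1 then (1 : L) else 0) //
              𝒪H.TransfersTo H' endoForm_antidiagOne (stableClassOf (cmConjRingHom L) H' γ₀)} → cartanIndexCM hH hHd hreg)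
        (e : {𝒪H : StableClassH (cmConjRingHom L) (Matrix.of fun i j : Fin 2 => if i.val + j.val + 1 = 2 then (1 : L) else 0)
                (Matrix.of fun i j : Fin 1 => if i.val + j.val + 1 = 1 then (1 : L) else 0) //
              𝒪H.TransfersTo H' endoForm_antidiagOne (stableClassOf (cmConjRingHom L) H' γ₀)} ≃
            {χ : (⊤ : Subgroup (AddChar ↥(cartanObsSubgroup (cartanIndexCM hH hHd hreg)) ℂ)) // χ ≠ 1}),
        Function.Injective s →
        (∀ 𝔪 : cartanIndexCM hH hHd hreg, (∃ x, s x = 𝔪) ↔ Module.finrank L (↥(Algebra.adjoin L ({(((γ₀ : unitaryGroup (cmConjRingHom L) H').val : GL (Fin 3) L) : Matrix (Fin 3) (Fin 3) L)} :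
                    Set (Matrix (Fin 3) (Fin 3) L))) ⧸ 𝔪.1.asIdeal) = 1) →
        (∀ x, (⟨(((γ₀ : unitaryGroup (cmConjRingHom L) H').val : GL (Fin 3) L) : Matrix (Fin 3) (Fin 3) L), Algebra.self_mem_adjoin_singleton L _⟩ :
                ↥(Algebra.adjoin L ({(((γ₀ : unitaryGroup (cmConjRingHom L) H').val : GL (Fin 3) L) : Matrix (Fin 3) (Fin 3) L)} :
                    Set (Matrix (Fin 3) (Fin 3) L)))) -
            algebraMap L _ x.1.sndVal ∈ (s x).1.asIdeal) →
        (∀ x (ε : ↥(cartanObsSubgroup (cartanIndexCM hH hHd hreg))),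
            (((e x : (⊤ : Subgroup (AddChar ↥(cartanObsSubgroup (cartanIndexCM hH hHd hreg)) ℂ))) : AddChar ↥(cartanObsSubgroup (cartanIndexCM hH hHd hreg)) ℂ)) ε =
              (-1 : ℂ) ^ ((ε : cartanIndexCM hH hHd hreg → ZMod 2) (s x)).val) →
        ∀ (γH : (UnitaryGroup.cmDatum L 2 (Matrix.of fun i j : Fin 2 => if i.val + j.val + 1 = 2 then (1 : L) else 0)).Rational ×
            (UnitaryGroup.cmDatum L 1 (Matrix.of fun i j : Fin 1 => if i.val + j.val + 1 = 1 then (1 : L) else 0)).Rational)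
          (hγ : IsNormPair L H' γH γ₀),
          GlobalKappaFormula L H' (finExplicitCollection L H' μ (finExplicitDelta_conj_left_all L H' μ) (finExplicitDelta_conj_right_all L H' μ))
            (fun a b => archCanonicalDelta L H' a μ b)
            (fun p : MatchingAdele L H' γH => MatchingAdeleG₂.cartanObs hH hHd hreg (MatchingAdele.toSelf hγ p))
            (((e ⟨stableClassHOf (cmConjRingHom L) _ _ γH, hγ⟩).1 :
                (⊤ : Subgroup (AddChar ↥(cartanObsSubgroup (cartanIndexCM hH hHd hreg)) ℂ))) : AddChar ↥(cartanObsSubgroup (cartanIndexCM hH hHd hreg)) ℂ)) :=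
  F0P3aGlobalTransferCartanKappaPaydown.globalTransferCartanKappa_pointed L H' μ νH νG hμu hμω hherm hanis

include hμω in
/-- **STUB (Q-CMᵀ) — LETTER BY NAME: ROGAWSKI'S CM CHARACTER IDENTITIES ON TEST FUNCTIONS, AT HIS OWN TRANSFER FACTOR `Δ‴` AND COMPATIBLE MEASURES** — ★
`CMCharIdentityPackageTest` (A-p19 (g21) ★ p840183, the `C_c^∞` twin of ★ `CMCharIdentityPackage`: [13.1.4] at every non-split finite place, Lemma 4.13.1 (b) at every split
place, for every one-dimensional automorphic `ξ` of `H`, the identity `χ_ξ(f^H) = Σ_{π ∈ Π(ξ)} ⟨ξ, π⟩ χ_π(f)` quantified over MATCHED TEST PAIRS `(f^H, f)` — `IsLocSmooth`, print's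
`C(G, ω)` [§4.1 p. 40, §1.6 p. 6]) for the explicit collection `Δ‴ = finExplicitCollection L H′ μ …` and EVERY pair `(mH, mG)` of CANONICAL orbital measure families (print's
«compatible measures», §4.3 p. 43; canonical families agree on the regular classes, ★ `IsCanonical.eq_of_isCanonical`).  Print: «`χ_ξ(f^H) = Σ_{π ∈ Π(ξ)} ⟨ξ, π⟩ χ_π(f)`»
[Prop. 13.1.4 p. 199] with `f ↦ f^H` THE transfer defined by `Δ_{G∕H} = τ·D_{G∕H}·(κ-weights)` of §4.9 p. 55 = `Δ‴` — so AT `Δ‴` the identity letter is print's sentence (the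
(V29) Δ-twist caveat concerns anonymous witnesses only); the `μ` of §4.9 and of §13.1 is the same auxiliary character (`μω := μ`).  Under the μ-GUARD `hμu hμω` (without it `Δ‴` is
not a transfer factor and the letter would not be print's).  ED. 3ᵀ: this is ED. 2's (Q-CM) with the ONE head token `CMCharIdentityPackage ↦ CMCharIdentityPackageTest` (the ED. 2
text was junk-vacuous: F0P3b FINDING-QCM-JUNK, `F0_P3b_QCMJunkObstruction.lean`); binder block = F0P3b's `QCMT` ∕ the closer's `stub_QCMT` (#86T) — ONE letter.  Consumed by the
CM corollary head only; the generic head carries `Q` as the frame hypothesis `hQ`.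
[cite: Rogawski1990, §13.1 Prop. 13.1.4 p. 199; §4.13 Lemma 4.13.1 (b) p. 63; §12.2 p. 174; §4.9 p. 55; §4.1 p. 40] -/
theorem stub_cmCharIdentityTest_explicit (hherm : (H'.map (cmConjRingHom L))ᵀ = H')
    (hanis : ∀ x : Fin 3 → L, hermForm (cmConjRingHom L) H' x x = 0 → x = 0) :
      letI : ∀ (v : HeightOneSpectrum (𝓞 ↥(maximalRealSubfield L)))
          (a : ((UnitaryGroup.cmDatum L 2 (Matrix.of fun i j : Fin 2 => if i.val + j.val + 1 = 2 then (1 : L) else 0)).Local v ×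
            (UnitaryGroup.cmDatum L 1 (Matrix.of fun i j : Fin 1 => if i.val + j.val + 1 = 1 then (1 : L) else 0)).Local v)),
          MeasurableSpace (((UnitaryGroup.cmDatum L 2 (Matrix.of fun i j : Fin 2 => if i.val + j.val + 1 = 2 then (1 : L) else 0)).Local v ×
            (UnitaryGroup.cmDatum L 1 (Matrix.of fun i j : Fin 1 => if i.val + j.val + 1 = 1 then (1 : L) else 0)).Local v) ⧸
            Subgroup.centralizer ({a} : Set ((UnitaryGroup.cmDatum L 2 (Matrix.of fun i j : Fin 2 => if i.val + j.val + 1 = 2 then (1 : L) else 0)).Local v ×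
            (UnitaryGroup.cmDatum L 1 (Matrix.of fun i j : Fin 1 => if i.val + j.val + 1 = 1 then (1 : L) else 0)).Local v))) :=
        fun _ _ => borel _
      haveI : ∀ (v : HeightOneSpectrum (𝓞 ↥(maximalRealSubfield L)))
          (a : ((UnitaryGroup.cmDatum L 2 (Matrix.of fun i j : Fin 2 => if i.val + j.val + 1 = 2 then (1 : L) else 0)).Local v ×
            (UnitaryGroup.cmDatum L 1 (Matrix.of fun i j : Fin 1 => if i.val + j.val + 1 = 1 then (1 : L) else 0)).Local v)),
          BorelSpace (((UnitaryGroup.cmDatum L 2 (Matrix.of fun i j : Fin 2 => if i.val + j.val + 1 = 2 then (1 : L) else 0)).Local v ×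
            (UnitaryGroup.cmDatum L 1 (Matrix.of fun i j : Fin 1 => if i.val + j.val + 1 = 1 then (1 : L) else 0)).Local v) ⧸
            Subgroup.centralizer ({a} : Set ((UnitaryGroup.cmDatum L 2 (Matrix.of fun i j : Fin 2 => if i.val + j.val + 1 = 2 then (1 : L) else 0)).Local v ×
            (UnitaryGroup.cmDatum L 1 (Matrix.of fun i j : Fin 1 => if i.val + j.val + 1 = 1 then (1 : L) else 0)).Local v))) :=
        fun _ _ => ⟨rfl⟩
      letI : ∀ (v : HeightOneSpectrum (𝓞 ↥(maximalRealSubfield L))) (γ : (UnitaryGroup.cmDatum L 3 H').Local v),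
          MeasurableSpace ((UnitaryGroup.cmDatum L 3 H').Local v ⧸ Subgroup.centralizer ({γ} : Set ((UnitaryGroup.cmDatum L 3 H').Local v))) :=
        fun _ _ => borel _
      haveI : ∀ (v : HeightOneSpectrum (𝓞 ↥(maximalRealSubfield L))) (γ : (UnitaryGroup.cmDatum L 3 H').Local v),
          BorelSpace ((UnitaryGroup.cmDatum L 3 H').Local v ⧸ Subgroup.centralizer ({γ} : Set ((UnitaryGroup.cmDatum L 3 H').Local v))) :=
        fun _ _ => ⟨rfl⟩
      ∀ (mH : ∀ v : HeightOneSpectrum (𝓞 ↥(maximalRealSubfield L)),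
          OrbitalMeasureFamily ((UnitaryGroup.cmDatum L 2 (Matrix.of fun i j : Fin 2 => if i.val + j.val + 1 = 2 then (1 : L) else 0)).Local v ×
          (UnitaryGroup.cmDatum L 1 (Matrix.of fun i j : Fin 1 => if i.val + j.val + 1 = 1 then (1 : L) else 0)).Local v))
        (mG : ∀ v : HeightOneSpectrum (𝓞 ↥(maximalRealSubfield L)), OrbitalMeasureFamily ((UnitaryGroup.cmDatum L 3 H').Local v)),
        (∀ v : HeightOneSpectrum (𝓞 ↥(maximalRealSubfield L)),
            (mH v).IsCanonical (IsLocalGRegular L v) (νH v) ∧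
              (mG v).IsCanonical (fun γ => IsRegularElt (γ.val : GL (Fin 3) (UnitaryGroup.LocalRing L v))) (νG v)) →
          CMCharIdentityPackageTest L H' hherm (isUnit_iff_ne_zero.mpr (Godement.det_ne_zero_of_anisotropic L H' hanis)) νH νG μ hμu
            (finExplicitCollection L H' μ (finExplicitDelta_conj_left_all L H' μ) (finExplicitDelta_conj_right_all L H' μ)) mH mG := by
  sorry

end Stubs


/-! ## §2 The kernel-checked composition: (J‴) + (PKG-pt) + `hQ` ⟹ ★ `GlobalTransferWithStabilisationPackageAnd … Δ‴_∞ νH νG Q` BY NAME (no `sorry`) -/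

section Composition

variable (Q : letI : ∀ (v : HeightOneSpectrum (𝓞 ↥(maximalRealSubfield L)))
          (a : ((UnitaryGroup.cmDatum L 2 (Matrix.of fun i j : Fin 2 => if i.val + j.val + 1 = 2 then (1 : L) else 0)).Local v ×
            (UnitaryGroup.cmDatum L 1 (Matrix.of fun i j : Fin 1 => if i.val + j.val + 1 = 1 then (1 : L) else 0)).Local v)),
          MeasurableSpace (((UnitaryGroup.cmDatum L 2 (Matrix.of fun i j : Fin 2 => if i.val + j.val + 1 = 2 then (1 : L) else 0)).Local v ×
            (UnitaryGroup.cmDatum L 1 (Matrix.of fun i j : Fin 1 => if i.val + j.val + 1 = 1 then (1 : L) else 0)).Local v) ⧸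
            Subgroup.centralizer ({a} : Set ((UnitaryGroup.cmDatum L 2 (Matrix.of fun i j : Fin 2 => if i.val + j.val + 1 = 2 then (1 : L) else 0)).Local v ×
            (UnitaryGroup.cmDatum L 1 (Matrix.of fun i j : Fin 1 => if i.val + j.val + 1 = 1 then (1 : L) else 0)).Local v))) :=
        fun _ _ => borel _
      letI : ∀ (v : HeightOneSpectrum (𝓞 ↥(maximalRealSubfield L))) (γ : (UnitaryGroup.cmDatum L 3 H').Local v),
          MeasurableSpace ((UnitaryGroup.cmDatum L 3 H').Local v ⧸ Subgroup.centralizer ({γ} : Set ((UnitaryGroup.cmDatum L 3 H').Local v))) :=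
        fun _ _ => borel _
      (∀ v : HeightOneSpectrum (𝓞 ↥(maximalRealSubfield L)), LocalTransferFactor L H' v) →
      (∀ v : HeightOneSpectrum (𝓞 ↥(maximalRealSubfield L)),
        OrbitalMeasureFamily ((UnitaryGroup.cmDatum L 2 (Matrix.of fun i j : Fin 2 => if i.val + j.val + 1 = 2 then (1 : L) else 0)).Local v ×
          (UnitaryGroup.cmDatum L 1 (Matrix.of fun i j : Fin 1 => if i.val + j.val + 1 = 1 then (1 : L) else 0)).Local v)) →
      (∀ v : HeightOneSpectrum (𝓞 ↥(maximalRealSubfield L)), OrbitalMeasureFamily ((UnitaryGroup.cmDatum L 3 H').Local v)) → Prop)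

/-- **`GlobalTransferWithStabilisationPackageAnd L H′ Δ‴_∞ νH νG Q` FROM THE STUB TEXTS** (composition; `sorry`-free): open the pointed data `(S_bad, mH, mG)` of (J‴);
the first three conjuncts are (J‴)'s verbatim at `Δ := Δ‴`; the per-class package is `stabilisationPackage_pointed` applied to (J‴)'s κ-clause; the rider `Q Δ‴ mH mG` is `hQ`
at (J‴)'s canonical clauses. [cite: Rogawski1990, §4.9 Prop. 4.9.1 p. 55; §4.3 (4.3.3) p. 44; §3.3 Prop. 3.3.1 p. 22; §5.4 (5.4.5) p. 73; §13.1 p. 199] -/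
theorem globalTransferPackageAnd_of_stubs (hherm : (H'.map (cmConjRingHom L))ᵀ = H')
    (hJ :
    (∀ v : HeightOneSpectrum (𝓞 ↥(maximalRealSubfield L)),
      νG v (UnitaryGroup.cmLocalIntegralLevel L 3 H' v : Set ((UnitaryGroup.cmDatum L 3 H').Local v)) = 1) →
    (∀ v : HeightOneSpectrum (𝓞 ↥(maximalRealSubfield L)),
      νH v (((UnitaryGroup.cmLocalIntegralLevel L 2 (Matrix.of fun i j : Fin 2 => if i.val + j.val + 1 = 2 then (1 : L) else 0) v).prod
          (UnitaryGroup.cmLocalIntegralLevel L 1 (Matrix.of fun i j : Fin 1 => if i.val + j.val + 1 = 1 then (1 : L) else 0) v) :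
            Subgroup ((UnitaryGroup.cmDatum L 2 (Matrix.of fun i j : Fin 2 => if i.val + j.val + 1 = 2 then (1 : L) else 0)).Local v ×
              (UnitaryGroup.cmDatum L 1 (Matrix.of fun i j : Fin 1 => if i.val + j.val + 1 = 1 then (1 : L) else 0)).Local v)) :
          Set ((UnitaryGroup.cmDatum L 2 (Matrix.of fun i j : Fin 2 => if i.val + j.val + 1 = 2 then (1 : L) else 0)).Local v ×
            (UnitaryGroup.cmDatum L 1 (Matrix.of fun i j : Fin 1 => if i.val + j.val + 1 = 1 then (1 : L) else 0)).Local v)) = 1) →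
    letI : ∀ (v : HeightOneSpectrum (𝓞 ↥(maximalRealSubfield L)))
        (a : ((UnitaryGroup.cmDatum L 2 (Matrix.of fun i j : Fin 2 => if i.val + j.val + 1 = 2 then (1 : L) else 0)).Local v ×
          (UnitaryGroup.cmDatum L 1 (Matrix.of fun i j : Fin 1 => if i.val + j.val + 1 = 1 then (1 : L) else 0)).Local v)),
        MeasurableSpace (((UnitaryGroup.cmDatum L 2 (Matrix.of fun i j : Fin 2 => if i.val + j.val + 1 = 2 then (1 : L) else 0)).Local v ×
          (UnitaryGroup.cmDatum L 1 (Matrix.of fun i j : Fin 1 => if i.val + j.val + 1 = 1 then (1 : L) else 0)).Local v) ⧸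
          Subgroup.centralizer ({a} : Set ((UnitaryGroup.cmDatum L 2 (Matrix.of fun i j : Fin 2 => if i.val + j.val + 1 = 2 then (1 : L) else 0)).Local v ×
          (UnitaryGroup.cmDatum L 1 (Matrix.of fun i j : Fin 1 => if i.val + j.val + 1 = 1 then (1 : L) else 0)).Local v))) :=
      fun _ _ => borel _
    haveI : ∀ (v : HeightOneSpectrum (𝓞 ↥(maximalRealSubfield L)))
        (a : ((UnitaryGroup.cmDatum L 2 (Matrix.of fun i j : Fin 2 => if i.val + j.val + 1 = 2 then (1 : L) else 0)).Local v ×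
          (UnitaryGroup.cmDatum L 1 (Matrix.of fun i j : Fin 1 => if i.val + j.val + 1 = 1 then (1 : L) else 0)).Local v)),
        BorelSpace (((UnitaryGroup.cmDatum L 2 (Matrix.of fun i j : Fin 2 => if i.val + j.val + 1 = 2 then (1 : L) else 0)).Local v ×
          (UnitaryGroup.cmDatum L 1 (Matrix.of fun i j : Fin 1 => if i.val + j.val + 1 = 1 then (1 : L) else 0)).Local v) ⧸
          Subgroup.centralizer ({a} : Set ((UnitaryGroup.cmDatum L 2 (Matrix.of fun i j : Fin 2 => if i.val + j.val + 1 = 2 then (1 : L) else 0)).Local v ×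
          (UnitaryGroup.cmDatum L 1 (Matrix.of fun i j : Fin 1 => if i.val + j.val + 1 = 1 then (1 : L) else 0)).Local v))) :=
      fun _ _ => ⟨rfl⟩
    letI : ∀ (v : HeightOneSpectrum (𝓞 ↥(maximalRealSubfield L))) (γ : (UnitaryGroup.cmDatum L 3 H').Local v),
        MeasurableSpace ((UnitaryGroup.cmDatum L 3 H').Local v ⧸ Subgroup.centralizer ({γ} : Set ((UnitaryGroup.cmDatum L 3 H').Local v))) :=
      fun _ _ => borel _
    haveI : ∀ (v : HeightOneSpectrum (𝓞 ↥(maximalRealSubfield L))) (γ : (UnitaryGroup.cmDatum L 3 H').Local v),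
        BorelSpace ((UnitaryGroup.cmDatum L 3 H').Local v ⧸ Subgroup.centralizer ({γ} : Set ((UnitaryGroup.cmDatum L 3 H').Local v))) :=
      fun _ _ => ⟨rfl⟩
    ∃ (Sbad : Finset (HeightOneSpectrum (𝓞 ↥(maximalRealSubfield L))))
      (mH : ∀ v : HeightOneSpectrum (𝓞 ↥(maximalRealSubfield L)), OrbitalMeasureFamily ((UnitaryGroup.cmDatum L 2 (Matrix.of fun i j : Fin 2 => if i.val + j.val + 1 = 2 then (1 : L) else 0)).Local v ×
        (UnitaryGroup.cmDatum L 1 (Matrix.of fun i j : Fin 1 => if i.val + j.val + 1 = 1 then (1 : L) else 0)).Local v))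
      (mG : ∀ v : HeightOneSpectrum (𝓞 ↥(maximalRealSubfield L)), OrbitalMeasureFamily ((UnitaryGroup.cmDatum L 3 H').Local v)),
      (∀ v, IsLocalTransferDatum L H' v ((finExplicitCollection L H' μ (finExplicitDelta_conj_left_all L H' μ) (finExplicitDelta_conj_right_all L H' μ)) v) (mH v) (mG v) ∧
          (v ∉ Sbad → IsLocalUnitTransfer L H' v ((finExplicitCollection L H' μ (finExplicitDelta_conj_left_all L H' μ) (finExplicitDelta_conj_right_all L H' μ)) v) (mH v) (mG v)) ∧
          (mH v).IsCanonical (IsLocalGRegular L v) (νH v) ∧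
          (mG v).IsCanonical (fun γ => IsRegularElt (γ.val : GL (Fin 3) (UnitaryGroup.LocalRing L v))) (νG v)) ∧
        IsAlmostEverywhereTrivial L H' (finExplicitCollection L H' μ (finExplicitDelta_conj_left_all L H' μ) (finExplicitDelta_conj_right_all L H' μ)) ∧
        SatisfiesProductFormula L H' (finExplicitCollection L H' μ (finExplicitDelta_conj_left_all L H' μ) (finExplicitDelta_conj_right_all L H' μ))
      (fun a b => archCanonicalDelta L H' a μ b) ∧
        ((∀ x : Fin 3 → L, hermForm (cmConjRingHom L) H' x x = 0 → x = 0) →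
      ∀ (hH : (H'.map (cmConjRingHom L))ᵀ = H') (hHd : IsUnit H'.det)
        (γ₀ : (UnitaryGroup.cmDatum L 3 H').Rational) (hreg : IsRegularElt (γ₀.val : GL (Fin 3) L))
        [Fintype (cartanIndexCM hH hHd hreg)]
        (s : {𝒪H : StableClassH (cmConjRingHom L) (Matrix.of fun i j : Fin 2 => if i.val + j.val + 1 = 2 then (1 : L) else 0)
                (Matrix.of fun i j : Fin 1 => if i.val + j.val + 1 = 1 then (1 : L) else 0) //
              𝒪H.TransfersTo H' endoForm_antidiagOne (stableClassOf (cmConjRingHom L) H' γ₀)} → cartanIndexCM hH hHd hreg)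
        (e : {𝒪H : StableClassH (cmConjRingHom L) (Matrix.of fun i j : Fin 2 => if i.val + j.val + 1 = 2 then (1 : L) else 0)
                (Matrix.of fun i j : Fin 1 => if i.val + j.val + 1 = 1 then (1 : L) else 0) //
              𝒪H.TransfersTo H' endoForm_antidiagOne (stableClassOf (cmConjRingHom L) H' γ₀)} ≃
            {χ : (⊤ : Subgroup (AddChar ↥(cartanObsSubgroup (cartanIndexCM hH hHd hreg)) ℂ)) // χ ≠ 1}),
        Function.Injective s →
        (∀ 𝔪 : cartanIndexCM hH hHd hreg, (∃ x, s x = 𝔪) ↔ Module.finrank L (↥(Algebra.adjoin L ({(((γ₀ : unitaryGroup (cmConjRingHom L) H').val : GL (Fin 3) L) : Matrix (Fin 3) (Fin 3) L)} :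
                    Set (Matrix (Fin 3) (Fin 3) L))) ⧸ 𝔪.1.asIdeal) = 1) →
        (∀ x, (⟨(((γ₀ : unitaryGroup (cmConjRingHom L) H').val : GL (Fin 3) L) : Matrix (Fin 3) (Fin 3) L), Algebra.self_mem_adjoin_singleton L _⟩ :
                ↥(Algebra.adjoin L ({(((γ₀ : unitaryGroup (cmConjRingHom L) H').val : GL (Fin 3) L) : Matrix (Fin 3) (Fin 3) L)} :
                    Set (Matrix (Fin 3) (Fin 3) L)))) -
            algebraMap L _ x.1.sndVal ∈ (s x).1.asIdeal) →
        (∀ x (ε : ↥(cartanObsSubgroup (cartanIndexCM hH hHd hreg))),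
            (((e x : (⊤ : Subgroup (AddChar ↥(cartanObsSubgroup (cartanIndexCM hH hHd hreg)) ℂ))) : AddChar ↥(cartanObsSubgroup (cartanIndexCM hH hHd hreg)) ℂ)) ε =
              (-1 : ℂ) ^ ((ε : cartanIndexCM hH hHd hreg → ZMod 2) (s x)).val) →
        ∀ (γH : (UnitaryGroup.cmDatum L 2 (Matrix.of fun i j : Fin 2 => if i.val + j.val + 1 = 2 then (1 : L) else 0)).Rational ×
            (UnitaryGroup.cmDatum L 1 (Matrix.of fun i j : Fin 1 => if i.val + j.val + 1 = 1 then (1 : L) else 0)).Rational)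
          (hγ : IsNormPair L H' γH γ₀),
          GlobalKappaFormula L H' (finExplicitCollection L H' μ (finExplicitDelta_conj_left_all L H' μ) (finExplicitDelta_conj_right_all L H' μ))
            (fun a b => archCanonicalDelta L H' a μ b)
            (fun p : MatchingAdele L H' γH => MatchingAdeleG₂.cartanObs hH hHd hreg (MatchingAdele.toSelf hγ p))
            (((e ⟨stableClassHOf (cmConjRingHom L) _ _ γH, hγ⟩).1 :
                (⊤ : Subgroup (AddChar ↥(cartanObsSubgroup (cartanIndexCM hH hHd hreg)) ℂ))) : AddChar ↥(cartanObsSubgroup (cartanIndexCM hH hHd hreg)) ℂ)))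
    (hQ :
      letI : ∀ (v : HeightOneSpectrum (𝓞 ↥(maximalRealSubfield L)))
          (a : ((UnitaryGroup.cmDatum L 2 (Matrix.of fun i j : Fin 2 => if i.val + j.val + 1 = 2 then (1 : L) else 0)).Local v ×
            (UnitaryGroup.cmDatum L 1 (Matrix.of fun i j : Fin 1 => if i.val + j.val + 1 = 1 then (1 : L) else 0)).Local v)),
          MeasurableSpace (((UnitaryGroup.cmDatum L 2 (Matrix.of fun i j : Fin 2 => if i.val + j.val + 1 = 2 then (1 : L) else 0)).Local v ×
            (UnitaryGroup.cmDatum L 1 (Matrix.of fun i j : Fin 1 => if i.val + j.val + 1 = 1 then (1 : L) else 0)).Local v) ⧸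
            Subgroup.centralizer ({a} : Set ((UnitaryGroup.cmDatum L 2 (Matrix.of fun i j : Fin 2 => if i.val + j.val + 1 = 2 then (1 : L) else 0)).Local v ×
            (UnitaryGroup.cmDatum L 1 (Matrix.of fun i j : Fin 1 => if i.val + j.val + 1 = 1 then (1 : L) else 0)).Local v))) :=
        fun _ _ => borel _
      haveI : ∀ (v : HeightOneSpectrum (𝓞 ↥(maximalRealSubfield L)))
          (a : ((UnitaryGroup.cmDatum L 2 (Matrix.of fun i j : Fin 2 => if i.val + j.val + 1 = 2 then (1 : L) else 0)).Local v ×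
            (UnitaryGroup.cmDatum L 1 (Matrix.of fun i j : Fin 1 => if i.val + j.val + 1 = 1 then (1 : L) else 0)).Local v)),
          BorelSpace (((UnitaryGroup.cmDatum L 2 (Matrix.of fun i j : Fin 2 => if i.val + j.val + 1 = 2 then (1 : L) else 0)).Local v ×
            (UnitaryGroup.cmDatum L 1 (Matrix.of fun i j : Fin 1 => if i.val + j.val + 1 = 1 then (1 : L) else 0)).Local v) ⧸
            Subgroup.centralizer ({a} : Set ((UnitaryGroup.cmDatum L 2 (Matrix.of fun i j : Fin 2 => if i.val + j.val + 1 = 2 then (1 : L) else 0)).Local v ×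
            (UnitaryGroup.cmDatum L 1 (Matrix.of fun i j : Fin 1 => if i.val + j.val + 1 = 1 then (1 : L) else 0)).Local v))) :=
        fun _ _ => ⟨rfl⟩
      letI : ∀ (v : HeightOneSpectrum (𝓞 ↥(maximalRealSubfield L))) (γ : (UnitaryGroup.cmDatum L 3 H').Local v),
          MeasurableSpace ((UnitaryGroup.cmDatum L 3 H').Local v ⧸ Subgroup.centralizer ({γ} : Set ((UnitaryGroup.cmDatum L 3 H').Local v))) :=
        fun _ _ => borel _
      haveI : ∀ (v : HeightOneSpectrum (𝓞 ↥(maximalRealSubfield L))) (γ : (UnitaryGroup.cmDatum L 3 H').Local v),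
          BorelSpace ((UnitaryGroup.cmDatum L 3 H').Local v ⧸ Subgroup.centralizer ({γ} : Set ((UnitaryGroup.cmDatum L 3 H').Local v))) :=
        fun _ _ => ⟨rfl⟩
      ∀ (mH : ∀ v : HeightOneSpectrum (𝓞 ↥(maximalRealSubfield L)),
          OrbitalMeasureFamily ((UnitaryGroup.cmDatum L 2 (Matrix.of fun i j : Fin 2 => if i.val + j.val + 1 = 2 then (1 : L) else 0)).Local v ×
          (UnitaryGroup.cmDatum L 1 (Matrix.of fun i j : Fin 1 => if i.val + j.val + 1 = 1 then (1 : L) else 0)).Local v))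
        (mG : ∀ v : HeightOneSpectrum (𝓞 ↥(maximalRealSubfield L)), OrbitalMeasureFamily ((UnitaryGroup.cmDatum L 3 H').Local v)),
        (∀ v : HeightOneSpectrum (𝓞 ↥(maximalRealSubfield L)),
            (mH v).IsCanonical (IsLocalGRegular L v) (νH v) ∧
              (mG v).IsCanonical (fun γ => IsRegularElt (γ.val : GL (Fin 3) (UnitaryGroup.LocalRing L v))) (νG v)) →
          Q (finExplicitCollection L H' μ (finExplicitDelta_conj_left_all L H' μ) (finExplicitDelta_conj_right_all L H' μ)) mH mG) :
    GlobalTransferWithStabilisationPackageAnd L H' (fun a b => archCanonicalDelta L H' a μ b) νH νG Q := by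
  intro hKG hKH
  obtain ⟨Sbad, mH, mG, hloc, hae, hpf, hκ⟩ := hJ hKG hKH
  exact ⟨Sbad, (finExplicitCollection L H' μ (finExplicitDelta_conj_left_all L H' μ) (finExplicitDelta_conj_right_all L H' μ)), mH, mG, hloc, hae, hpf,
    stabilisationPackage_pointed L H' (fun a b => archCanonicalDelta L H' a μ b)
      (finExplicitCollection L H' μ (finExplicitDelta_conj_left_all L H' μ) (finExplicitDelta_conj_right_all L H' μ)) hherm hκ,
    hQ mH mG fun v => ⟨(hloc v).2.2.1, (hloc v).2.2.2⟩⟩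

end Composition

/-! ## §3 Heads over the stubs -/

section Heads

variable (hμu : μ.IsUnitary)
  (hμω : ∀ x : ideleGroup ↥(maximalRealSubfield L), μ (AdeleRing.ideleBaseChange (↥(maximalRealSubfield L)) L x) = quadraticHeckeCharCM L x)
variable (Q : letI : ∀ (v : HeightOneSpectrum (𝓞 ↥(maximalRealSubfield L)))
          (a : ((UnitaryGroup.cmDatum L 2 (Matrix.of fun i j : Fin 2 => if i.val + j.val + 1 = 2 then (1 : L) else 0)).Local v ×
            (UnitaryGroup.cmDatum L 1 (Matrix.of fun i j : Fin 1 => if i.val + j.val + 1 = 1 then (1 : L) else 0)).Local v)),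
          MeasurableSpace (((UnitaryGroup.cmDatum L 2 (Matrix.of fun i j : Fin 2 => if i.val + j.val + 1 = 2 then (1 : L) else 0)).Local v ×
            (UnitaryGroup.cmDatum L 1 (Matrix.of fun i j : Fin 1 => if i.val + j.val + 1 = 1 then (1 : L) else 0)).Local v) ⧸
            Subgroup.centralizer ({a} : Set ((UnitaryGroup.cmDatum L 2 (Matrix.of fun i j : Fin 2 => if i.val + j.val + 1 = 2 then (1 : L) else 0)).Local v ×
            (UnitaryGroup.cmDatum L 1 (Matrix.of fun i j : Fin 1 => if i.val + j.val + 1 = 1 then (1 : L) else 0)).Local v))) :=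
        fun _ _ => borel _
      letI : ∀ (v : HeightOneSpectrum (𝓞 ↥(maximalRealSubfield L))) (γ : (UnitaryGroup.cmDatum L 3 H').Local v),
          MeasurableSpace ((UnitaryGroup.cmDatum L 3 H').Local v ⧸ Subgroup.centralizer ({γ} : Set ((UnitaryGroup.cmDatum L 3 H').Local v))) :=
        fun _ _ => borel _
      (∀ v : HeightOneSpectrum (𝓞 ↥(maximalRealSubfield L)), LocalTransferFactor L H' v) →
      (∀ v : HeightOneSpectrum (𝓞 ↥(maximalRealSubfield L)),
        OrbitalMeasureFamily ((UnitaryGroup.cmDatum L 2 (Matrix.of fun i j : Fin 2 => if i.val + j.val + 1 = 2 then (1 : L) else 0)).Local v ×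
          (UnitaryGroup.cmDatum L 1 (Matrix.of fun i j : Fin 1 => if i.val + j.val + 1 = 1 then (1 : L) else 0)).Local v)) →
      (∀ v : HeightOneSpectrum (𝓞 ↥(maximalRealSubfield L)), OrbitalMeasureFamily ((UnitaryGroup.cmDatum L 3 H').Local v)) → Prop)

include hμu hμω in
/-- **GENERIC HEAD: ★ `GlobalTransferWithStabilisationPackageAnd L H′ Δ‴_∞ νH νG Q`** at `Δ‴_∞ = fun a b => archCanonicalDelta L H′ a μ b`, over the junction stub (J‴) and
the frame hypothesis `hQ` («`Q Δ‴ mH mG` for every pair of canonical families» — the consumer's rider at PRINT'S witness); `sorry`-tainted only through (J‴).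
[cite: Rogawski1990, §4.9 Prop. 4.9.1 p. 55; §4.3 (4.3.3) p. 44; §13.1 p. 199] -/
theorem globalTransferPackageAnd_holds (hherm : (H'.map (cmConjRingHom L))ᵀ = H')
    (hanis : ∀ x : Fin 3 → L, hermForm (cmConjRingHom L) H' x x = 0 → x = 0)
    (hQ :
      letI : ∀ (v : HeightOneSpectrum (𝓞 ↥(maximalRealSubfield L)))
          (a : ((UnitaryGroup.cmDatum L 2 (Matrix.of fun i j : Fin 2 => if i.val + j.val + 1 = 2 then (1 : L) else 0)).Local v ×
            (UnitaryGroup.cmDatum L 1 (Matrix.of fun i j : Fin 1 => if i.val + j.val + 1 = 1 then (1 : L) else 0)).Local v)),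
          MeasurableSpace (((UnitaryGroup.cmDatum L 2 (Matrix.of fun i j : Fin 2 => if i.val + j.val + 1 = 2 then (1 : L) else 0)).Local v ×
            (UnitaryGroup.cmDatum L 1 (Matrix.of fun i j : Fin 1 => if i.val + j.val + 1 = 1 then (1 : L) else 0)).Local v) ⧸
            Subgroup.centralizer ({a} : Set ((UnitaryGroup.cmDatum L 2 (Matrix.of fun i j : Fin 2 => if i.val + j.val + 1 = 2 then (1 : L) else 0)).Local v ×
            (UnitaryGroup.cmDatum L 1 (Matrix.of fun i j : Fin 1 => if i.val + j.val + 1 = 1 then (1 : L) else 0)).Local v))) :=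
        fun _ _ => borel _
      haveI : ∀ (v : HeightOneSpectrum (𝓞 ↥(maximalRealSubfield L)))
          (a : ((UnitaryGroup.cmDatum L 2 (Matrix.of fun i j : Fin 2 => if i.val + j.val + 1 = 2 then (1 : L) else 0)).Local v ×
            (UnitaryGroup.cmDatum L 1 (Matrix.of fun i j : Fin 1 => if i.val + j.val + 1 = 1 then (1 : L) else 0)).Local v)),
          BorelSpace (((UnitaryGroup.cmDatum L 2 (Matrix.of fun i j : Fin 2 => if i.val + j.val + 1 = 2 then (1 : L) else 0)).Local v ×
            (UnitaryGroup.cmDatum L 1 (Matrix.of fun i j : Fin 1 => if i.val + j.val + 1 = 1 then (1 : L) else 0)).Local v) ⧸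
            Subgroup.centralizer ({a} : Set ((UnitaryGroup.cmDatum L 2 (Matrix.of fun i j : Fin 2 => if i.val + j.val + 1 = 2 then (1 : L) else 0)).Local v ×
            (UnitaryGroup.cmDatum L 1 (Matrix.of fun i j : Fin 1 => if i.val + j.val + 1 = 1 then (1 : L) else 0)).Local v))) :=
        fun _ _ => ⟨rfl⟩
      letI : ∀ (v : HeightOneSpectrum (𝓞 ↥(maximalRealSubfield L))) (γ : (UnitaryGroup.cmDatum L 3 H').Local v),
          MeasurableSpace ((UnitaryGroup.cmDatum L 3 H').Local v ⧸ Subgroup.centralizer ({γ} : Set ((UnitaryGroup.cmDatum L 3 H').Local v))) :=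
        fun _ _ => borel _
      haveI : ∀ (v : HeightOneSpectrum (𝓞 ↥(maximalRealSubfield L))) (γ : (UnitaryGroup.cmDatum L 3 H').Local v),
          BorelSpace ((UnitaryGroup.cmDatum L 3 H').Local v ⧸ Subgroup.centralizer ({γ} : Set ((UnitaryGroup.cmDatum L 3 H').Local v))) :=
        fun _ _ => ⟨rfl⟩
      ∀ (mH : ∀ v : HeightOneSpectrum (𝓞 ↥(maximalRealSubfield L)),
          OrbitalMeasureFamily ((UnitaryGroup.cmDatum L 2 (Matrix.of fun i j : Fin 2 => if i.val + j.val + 1 = 2 then (1 : L) else 0)).Local v ×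
          (UnitaryGroup.cmDatum L 1 (Matrix.of fun i j : Fin 1 => if i.val + j.val + 1 = 1 then (1 : L) else 0)).Local v))
        (mG : ∀ v : HeightOneSpectrum (𝓞 ↥(maximalRealSubfield L)), OrbitalMeasureFamily ((UnitaryGroup.cmDatum L 3 H').Local v)),
        (∀ v : HeightOneSpectrum (𝓞 ↥(maximalRealSubfield L)),
            (mH v).IsCanonical (IsLocalGRegular L v) (νH v) ∧
              (mG v).IsCanonical (fun γ => IsRegularElt (γ.val : GL (Fin 3) (UnitaryGroup.LocalRing L v))) (νG v)) →
          Q (finExplicitCollection L H' μ (finExplicitDelta_conj_left_all L H' μ) (finExplicitDelta_conj_right_all L H' μ)) mH mG) :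
    GlobalTransferWithStabilisationPackageAnd L H' (fun a b => archCanonicalDelta L H' a μ b) νH νG Q :=
  globalTransferPackageAnd_of_stubs L H' μ νH νG Q hherm (stub_globalTransferCartanKappa_pointed L H' μ νH νG hμu hμω hherm hanis) hQ

include hμu hμω in
/-- The same head at the archimedean TRANSFER-FACTOR DATUM ★ `archCanonicalTransferFactor L H′ μ` — the spelling `Tinf.Δ` of the T1 export's binder
`hGTQ : GlobalTransferWithStabilisationPackageAnd L H Tinf.Δ νH νG Q` at rung 0 (`(archCanonicalTransferFactor L H′ μ).Δ = fun a b => archCanonicalDelta L H′ a μ b` by `rfl`).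
[cite: Rogawski1990, §14.6 p. 242; §4.9 p. 55] -/
theorem globalTransferPackageAnd_holds' (hherm : (H'.map (cmConjRingHom L))ᵀ = H')
    (hanis : ∀ x : Fin 3 → L, hermForm (cmConjRingHom L) H' x x = 0 → x = 0)
    (hQ :
      letI : ∀ (v : HeightOneSpectrum (𝓞 ↥(maximalRealSubfield L)))
          (a : ((UnitaryGroup.cmDatum L 2 (Matrix.of fun i j : Fin 2 => if i.val + j.val + 1 = 2 then (1 : L) else 0)).Local v ×
            (UnitaryGroup.cmDatum L 1 (Matrix.of fun i j : Fin 1 => if i.val + j.val + 1 = 1 then (1 : L) else 0)).Local v)),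
          MeasurableSpace (((UnitaryGroup.cmDatum L 2 (Matrix.of fun i j : Fin 2 => if i.val + j.val + 1 = 2 then (1 : L) else 0)).Local v ×
            (UnitaryGroup.cmDatum L 1 (Matrix.of fun i j : Fin 1 => if i.val + j.val + 1 = 1 then (1 : L) else 0)).Local v) ⧸
            Subgroup.centralizer ({a} : Set ((UnitaryGroup.cmDatum L 2 (Matrix.of fun i j : Fin 2 => if i.val + j.val + 1 = 2 then (1 : L) else 0)).Local v ×
            (UnitaryGroup.cmDatum L 1 (Matrix.of fun i j : Fin 1 => if i.val + j.val + 1 = 1 then (1 : L) else 0)).Local v))) :=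
        fun _ _ => borel _
      haveI : ∀ (v : HeightOneSpectrum (𝓞 ↥(maximalRealSubfield L)))
          (a : ((UnitaryGroup.cmDatum L 2 (Matrix.of fun i j : Fin 2 => if i.val + j.val + 1 = 2 then (1 : L) else 0)).Local v ×
            (UnitaryGroup.cmDatum L 1 (Matrix.of fun i j : Fin 1 => if i.val + j.val + 1 = 1 then (1 : L) else 0)).Local v)),
          BorelSpace (((UnitaryGroup.cmDatum L 2 (Matrix.of fun i j : Fin 2 => if i.val + j.val + 1 = 2 then (1 : L) else 0)).Local v ×
            (UnitaryGroup.cmDatum L 1 (Matrix.of fun i j : Fin 1 => if i.val + j.val + 1 = 1 then (1 : L) else 0)).Local v) ⧸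
            Subgroup.centralizer ({a} : Set ((UnitaryGroup.cmDatum L 2 (Matrix.of fun i j : Fin 2 => if i.val + j.val + 1 = 2 then (1 : L) else 0)).Local v ×
            (UnitaryGroup.cmDatum L 1 (Matrix.of fun i j : Fin 1 => if i.val + j.val + 1 = 1 then (1 : L) else 0)).Local v))) :=
        fun _ _ => ⟨rfl⟩
      letI : ∀ (v : HeightOneSpectrum (𝓞 ↥(maximalRealSubfield L))) (γ : (UnitaryGroup.cmDatum L 3 H').Local v),
          MeasurableSpace ((UnitaryGroup.cmDatum L 3 H').Local v ⧸ Subgroup.centralizer ({γ} : Set ((UnitaryGroup.cmDatum L 3 H').Local v))) :=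
        fun _ _ => borel _
      haveI : ∀ (v : HeightOneSpectrum (𝓞 ↥(maximalRealSubfield L))) (γ : (UnitaryGroup.cmDatum L 3 H').Local v),
          BorelSpace ((UnitaryGroup.cmDatum L 3 H').Local v ⧸ Subgroup.centralizer ({γ} : Set ((UnitaryGroup.cmDatum L 3 H').Local v))) :=
        fun _ _ => ⟨rfl⟩
      ∀ (mH : ∀ v : HeightOneSpectrum (𝓞 ↥(maximalRealSubfield L)),
          OrbitalMeasureFamily ((UnitaryGroup.cmDatum L 2 (Matrix.of fun i j : Fin 2 => if i.val + j.val + 1 = 2 then (1 : L) else 0)).Local v ×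
          (UnitaryGroup.cmDatum L 1 (Matrix.of fun i j : Fin 1 => if i.val + j.val + 1 = 1 then (1 : L) else 0)).Local v))
        (mG : ∀ v : HeightOneSpectrum (𝓞 ↥(maximalRealSubfield L)), OrbitalMeasureFamily ((UnitaryGroup.cmDatum L 3 H').Local v)),
        (∀ v : HeightOneSpectrum (𝓞 ↥(maximalRealSubfield L)),
            (mH v).IsCanonical (IsLocalGRegular L v) (νH v) ∧
              (mG v).IsCanonical (fun γ => IsRegularElt (γ.val : GL (Fin 3) (UnitaryGroup.LocalRing L v))) (νG v)) →
          Q (finExplicitCollection L H' μ (finExplicitDelta_conj_left_all L H' μ) (finExplicitDelta_conj_right_all L H' μ)) mH mG) :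
    GlobalTransferWithStabilisationPackageAnd L H' (archCanonicalTransferFactor L H' μ).Δ νH νG Q :=
  globalTransferPackageAnd_holds L H' μ νH νG hμu hμω Q hherm hanis hQ

include hμu hμω in
/-- **CM COROLLARY ON TEST FUNCTIONS (ED. 3ᵀ): the joint letter «#72 ∧ Q_CMᵀ» at print's witness — ★ ED. 5 `GlobalTransferWithStabilisationPackageAnd L H′ Δ‴_∞ νH νG Q` at
`Q := CMCharIdentityPackageTest L H′ hherm hHd νH νG μ hμu`** (the Test twin of ★ P3b `GlobalTransferWithCMCharIdentities` = ED. 5 at `Q := CMCharIdentityPackage …`, RULING (V29) (J1);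
spelled through ED. 5 because no `…Test` joint-letter definition exists — a def-lane item if a consumer wants the name) — over (J‴) and the one CM letter (Q-CMᵀ).  Replaces ED. 2's
`globalTransferWithCMCharIdentities_explicit_holds`, whose conclusion carried the junk-vulnerable bare-function package (no consumer in the tree imported it).
[cite: Rogawski1990, Prop. 4.9.1 p. 55; (4.3.3) p. 44; §13.1 Prop. 13.1.4 p. 199; §4.13 Lemma 4.13.1 (b) p. 63; §12.2 p. 174] -/
theorem globalTransferWithCMCharIdentitiesTest_explicit_holds (hherm : (H'.map (cmConjRingHom L))ᵀ = H')
    (hanis : ∀ x : Fin 3 → L, hermForm (cmConjRingHom L) H' x x = 0 → x = 0) :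
    letI : ∀ (v : HeightOneSpectrum (𝓞 ↥(maximalRealSubfield L)))
        (a : ((UnitaryGroup.cmDatum L 2 (Matrix.of fun i j : Fin 2 => if i.val + j.val + 1 = 2 then (1 : L) else 0)).Local v ×
          (UnitaryGroup.cmDatum L 1 (Matrix.of fun i j : Fin 1 => if i.val + j.val + 1 = 1 then (1 : L) else 0)).Local v)),
        MeasurableSpace (((UnitaryGroup.cmDatum L 2 (Matrix.of fun i j : Fin 2 => if i.val + j.val + 1 = 2 then (1 : L) else 0)).Local v ×
          (UnitaryGroup.cmDatum L 1 (Matrix.of fun i j : Fin 1 => if i.val + j.val + 1 = 1 then (1 : L) else 0)).Local v) ⧸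
          Subgroup.centralizer ({a} : Set ((UnitaryGroup.cmDatum L 2 (Matrix.of fun i j : Fin 2 => if i.val + j.val + 1 = 2 then (1 : L) else 0)).Local v ×
          (UnitaryGroup.cmDatum L 1 (Matrix.of fun i j : Fin 1 => if i.val + j.val + 1 = 1 then (1 : L) else 0)).Local v))) :=
      fun _ _ => borel _
    letI : ∀ (v : HeightOneSpectrum (𝓞 ↥(maximalRealSubfield L))) (γ : (UnitaryGroup.cmDatum L 3 H').Local v),
        MeasurableSpace ((UnitaryGroup.cmDatum L 3 H').Local v ⧸ Subgroup.centralizer ({γ} : Set ((UnitaryGroup.cmDatum L 3 H').Local v))) :=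
      fun _ _ => borel _
    GlobalTransferWithStabilisationPackageAnd L H' (fun a b => archCanonicalDelta L H' a μ b) νH νG
      (CMCharIdentityPackageTest L H' hherm (isUnit_iff_ne_zero.mpr (Godement.det_ne_zero_of_anisotropic L H' hanis)) νH νG μ hμu) :=
  globalTransferPackageAnd_of_stubs L H' μ νH νG _ hherm (stub_globalTransferCartanKappa_pointed L H' μ νH νG hμu hμω hherm hanis)
    (stub_cmCharIdentityTest_explicit L H' μ νH νG hμu hμω hherm hanis)

end Heads

end Summit.HodgeConjecture.HodgeConjecture.Cruxes.H413.F0P3aGlobalTransferPackageAndPaydown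

end
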